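import Mathlib
import Summits.Ventures.PercRepro2.CoinChainXA
import Summits.Ventures.PercRepro2.CoinChainGenQprime

/-!
# The general AND-switch chain when the cross term is nonpositive, and from (XA′)
(blind cell PercRepro2, night-2 g25; proofs/NIGHT2-DARC.md §65)

With `Cross := (a0 b1 − a1 b0)(a0 e2 − a2 e0) + (a0 b2 − a2 b0)(a0 e1 − a1 e0)` — the cleared
cross-product `a0²·Λ¹M⁰(ε τ⁰ + φ σ⁰)` of the world shifts with the world-0 gate shifts — the
hypothesis (XA) of `chain_functional_nonneg_of_XA_Qprime` is EXACTLY (`chain_XA_identity`, a ring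
identity) `b0·(b0·U000 + a0·U001 − Cross) ≥ 0`.  Hence:
* `chain_functional_nonneg_of_cross_nonpos` — the general chain at every `ρ` whenever
  `Cross ≤ 0` (the world shift and the world-0 gate shift anti-aligned, or one of them zero; it
  contains the pure chain, where `G⁰ = R⁰` and `Cross = 0`): no further hypothesis, since
  `U000, U001 ≥ 0` are kernel facts;
* `chain_functional_nonneg_of_XA'` — the general chain from the sharper (XA′)
  `a0·U001 ≥ Cross` (census 0 / 6,600, adversarially tight; §65.5).
-/

namespace Summit.Ventures.PercRepro2.Coin

open Classical

section XACross

variable {R : Type*} [CommRing R]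

/-- `a0² U110 + a0 b0 U001 − e0 Δ = b0 (b0 U000 + a0 U001 − Cross)`. -/
theorem chain_XA_identity (a0 a1 a2 b0 b1 b2 e0 e1 e2 e12 g0 g1 g2 g12 : R) :
    a0 ^ 2 * (b0 * b0 * e12 - b0 * b2 * e1 - b0 * b1 * e2 + b1 * b2 * e0)
        + a0 * b0 * (a0 * a0 * g12 - a0 * a2 * g1 - a0 * a1 * g2 + a1 * a2 * g0)
        - e0 * ((b0 * a1 - a0 * b1) * (b0 * a2 - a0 * b2)) =
      b0 * (b0 * (a0 * a0 * e12 - a0 * a2 * e1 - a0 * a1 * e2 + a1 * a2 * e0)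
        + a0 * (a0 * a0 * g12 - a0 * a2 * g1 - a0 * a1 * g2 + a1 * a2 * g0)
        - ((a0 * b1 - a1 * b0) * (a0 * e2 - a2 * e0) + (a0 * b2 - a2 * b0) * (a0 * e1 - a1 * e0))) := by
  ring

end XACross

section XACrossChain

variable {V : Type*} [DecidableEq V] {R : Type*} [Field R] [LinearOrder R] [IsStrictOrderedRing R]

/-- **THE GENERAL AND-SWITCH CHAIN WHEN THE CROSS TERM IS NONPOSITIVE** (`Cross ≤ 0`): at every
`ρ ∈ [0, 1]`, for every pair of nonnegative increasing markers, under the head hypotheses,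
`d' ≤ d`, positive world masses and a positive ideal mass. -/
theorem chain_functional_nonneg_of_cross_nonpos (U ent ent' : Finset V) (ν c d d' : Finset V → R)
    (ρ : R) (hρ0 : 0 ≤ ρ) (hρ1 : ρ ≤ 1) (hν0 : ∀ W, 0 ≤ ν W)
    (hν : ∀ s ⊆ U, ∀ t ⊆ U, ν s * ν t ≤ ν (s ∩ t) * ν (s ∪ t))
    (hc0 : ∀ W, 0 ≤ c W) (hd0 : ∀ W, 0 ≤ d W) (hd'0 : ∀ W, 0 ≤ d' W)
    (hdc : ∀ W, d W ≤ c W) (hd'c : ∀ W, d' W ≤ c W) (hd'd : ∀ W, d' W ≤ d W)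
    (hcc : ∀ s t, c s * c t ≤ c (s ∩ t) * c (s ∪ t))
    (hdd : ∀ s t, d s * d t ≤ d (s ∩ t) * d (s ∪ t))
    (hd'd' : ∀ s t, d' s * d' t ≤ d' (s ∩ t) * d' (s ∪ t))
    (hcd : ∀ s t, c s * d t ≤ c (s ∩ t) * d (s ∪ t))
    (hcd' : ∀ s t, c s * d' t ≤ c (s ∩ t) * d' (s ∪ t))
    (hdd' : ∀ s t, d s * d' t ≤ d (s ∩ t) * d' (s ∪ t))
    (hratio : ∀ s t, s ⊆ t → d s * c t ≤ c s * d t)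
    (hratio' : ∀ s t, s ⊆ t → d' s * c t ≤ c s * d' t)
    (x y : Finset V → R) (hx0 : ∀ W, 0 ≤ x W) (hy0 : ∀ W, 0 ≤ y W)
    (hxm : ∀ s t, x s ≤ x (s ∪ t)) (hym : ∀ s t, y s ≤ y (s ∪ t))
    (hpos0 : 0 < ∑ W ∈ U.powerset, ν W * chainMix ent ent' 0 c d W)
    (hpos1 : 0 < ∑ W ∈ U.powerset, ν W * chainMix ent ent' 1 c d W)
    (hmI : 0 < ∑ W ∈ U.powerset.filter (fun W => ¬ ∃ r ∈ ent ∪ ent', r ∈ W), ν W * c W)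
    (hCross : (((∑ W ∈ U.powerset, ν W * chainMix ent ent' 0 c d W) * (∑ W ∈ U.powerset, ν W * chainMix ent ent' 1 c d W * x W) - (∑ W ∈ U.powerset, ν W * chainMix ent ent' 0 c d W * x W) * (∑ W ∈ U.powerset, ν W * chainMix ent ent' 1 c d W)) *
          ((∑ W ∈ U.powerset, ν W * chainMix ent ent' 0 c d W) * (∑ W ∈ U.powerset, ν W * chainMix ent ent' 0 c d' W * y W) - (∑ W ∈ U.powerset, ν W * chainMix ent ent' 0 c d W * y W) * (∑ W ∈ U.powerset, ν W * chainMix ent ent' 0 c d' W))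
        + ((∑ W ∈ U.powerset, ν W * chainMix ent ent' 0 c d W) * (∑ W ∈ U.powerset, ν W * chainMix ent ent' 1 c d W * y W) - (∑ W ∈ U.powerset, ν W * chainMix ent ent' 0 c d W * y W) * (∑ W ∈ U.powerset, ν W * chainMix ent ent' 1 c d W)) *
          ((∑ W ∈ U.powerset, ν W * chainMix ent ent' 0 c d W) * (∑ W ∈ U.powerset, ν W * chainMix ent ent' 0 c d' W * x W) - (∑ W ∈ U.powerset, ν W * chainMix ent ent' 0 c d W * x W) * (∑ W ∈ U.powerset, ν W * chainMix ent ent' 0 c d' W))) ≤ 0) :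
    0 ≤ (∑ W ∈ U.powerset, ν W * chainMix ent ent' ρ c d W) ^ 2 *
          (∑ W ∈ U.powerset, ν W * chainMix ent ent' ρ c d' W * (x W * y W))
        - (∑ W ∈ U.powerset, ν W * chainMix ent ent' ρ c d W) *
          (∑ W ∈ U.powerset, ν W * chainMix ent ent' ρ c d W * x W) *
          (∑ W ∈ U.powerset, ν W * chainMix ent ent' ρ c d' W * y W)
        - (∑ W ∈ U.powerset, ν W * chainMix ent ent' ρ c d W) *
          (∑ W ∈ U.powerset, ν W * chainMix ent ent' ρ c d W * y W) *
          (∑ W ∈ U.powerset, ν W * chainMix ent ent' ρ c d' W * x W)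
        + (∑ W ∈ U.powerset, ν W * chainMix ent ent' ρ c d W * x W) *
          (∑ W ∈ U.powerset, ν W * chainMix ent ent' ρ c d W * y W) *
          (∑ W ∈ U.powerset, ν W * chainMix ent ent' ρ c d' W) := by
  -- the kernel facts `U000 ≥ 0`, `U001 ≥ 0`
  have hU001 := chain_world1_mixed_nonneg U ent ent' ν c d d' 0 0 le_rfl zero_le_one le_rfl
    zero_le_one hν0 hν hc0 hd0 hd'0 hdc hd'c hcc hdd hd'd' hcd hcd' hdd' hratio hratio' x y hx0 hy0 hxm hym
  have hU000 := chain_world1_mixed_nonneg U ent ∅ ν c d d' 1 1 zero_le_one le_rfl zero_le_one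
    le_rfl hν0 hν hc0 hd0 hd'0 hdc hd'c hcc hdd hd'd' hcd hcd' hdd' hratio hratio' x y hx0 hy0 hxm hym
  simp only [← chainMix_zero_as_one_empty ent ent'] at hU000
  refine chain_functional_nonneg_of_XA_Qprime U ent ent' ν c d d' ρ hρ0 hρ1 hν0 hν hc0 hd0 hd'0 hdc
    hd'c hd'd hcc hdd hd'd' hcd hcd' hdd' hratio hratio' x y hx0 hy0 hxm hym hpos0 hpos1 ?_
    (chain_Qprime U ent ent' ν c d d' hν0 hν hc0 hd0 hd'0 hdc hd'c hd'd hcc hdd hd'd' hcd hcd' hdd'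
      hratio hratio' x y hx0 hy0 hxm hym hpos0 hpos1 hmI)
  rw [chain_XA_identity]
  refine mul_nonneg hpos1.le ?_
  have h1 := mul_nonneg hpos1.le hU000
  have h2 := mul_nonneg hpos0.le hU001
  linarith

/-- **THE GENERAL AND-SWITCH CHAIN FROM (XA′)** `a0·U001 ≥ Cross` (the sharper form of (XA):
`Λ⁰·A₁₀ ≥ Λ¹M⁰(ε τ⁰ + φ σ⁰)`). -/
theorem chain_functional_nonneg_of_XA' (U ent ent' : Finset V) (ν c d d' : Finset V → R)
    (ρ : R) (hρ0 : 0 ≤ ρ) (hρ1 : ρ ≤ 1) (hν0 : ∀ W, 0 ≤ ν W)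
    (hν : ∀ s ⊆ U, ∀ t ⊆ U, ν s * ν t ≤ ν (s ∩ t) * ν (s ∪ t))
    (hc0 : ∀ W, 0 ≤ c W) (hd0 : ∀ W, 0 ≤ d W) (hd'0 : ∀ W, 0 ≤ d' W)
    (hdc : ∀ W, d W ≤ c W) (hd'c : ∀ W, d' W ≤ c W) (hd'd : ∀ W, d' W ≤ d W)
    (hcc : ∀ s t, c s * c t ≤ c (s ∩ t) * c (s ∪ t))
    (hdd : ∀ s t, d s * d t ≤ d (s ∩ t) * d (s ∪ t))
    (hd'd' : ∀ s t, d' s * d' t ≤ d' (s ∩ t) * d' (s ∪ t))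
    (hcd : ∀ s t, c s * d t ≤ c (s ∩ t) * d (s ∪ t))
    (hcd' : ∀ s t, c s * d' t ≤ c (s ∩ t) * d' (s ∪ t))
    (hdd' : ∀ s t, d s * d' t ≤ d (s ∩ t) * d' (s ∪ t))
    (hratio : ∀ s t, s ⊆ t → d s * c t ≤ c s * d t)
    (hratio' : ∀ s t, s ⊆ t → d' s * c t ≤ c s * d' t)
    (x y : Finset V → R) (hx0 : ∀ W, 0 ≤ x W) (hy0 : ∀ W, 0 ≤ y W)
    (hxm : ∀ s t, x s ≤ x (s ∪ t)) (hym : ∀ s t, y s ≤ y (s ∪ t))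
    (hpos0 : 0 < ∑ W ∈ U.powerset, ν W * chainMix ent ent' 0 c d W)
    (hpos1 : 0 < ∑ W ∈ U.powerset, ν W * chainMix ent ent' 1 c d W)
    (hmI : 0 < ∑ W ∈ U.powerset.filter (fun W => ¬ ∃ r ∈ ent ∪ ent', r ∈ W), ν W * c W)
    (hXA' : (((∑ W ∈ U.powerset, ν W * chainMix ent ent' 0 c d W) * (∑ W ∈ U.powerset, ν W * chainMix ent ent' 1 c d W * x W) - (∑ W ∈ U.powerset, ν W * chainMix ent ent' 0 c d W * x W) * (∑ W ∈ U.powerset, ν W * chainMix ent ent' 1 c d W)) *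
          ((∑ W ∈ U.powerset, ν W * chainMix ent ent' 0 c d W) * (∑ W ∈ U.powerset, ν W * chainMix ent ent' 0 c d' W * y W) - (∑ W ∈ U.powerset, ν W * chainMix ent ent' 0 c d W * y W) * (∑ W ∈ U.powerset, ν W * chainMix ent ent' 0 c d' W))
        + ((∑ W ∈ U.powerset, ν W * chainMix ent ent' 0 c d W) * (∑ W ∈ U.powerset, ν W * chainMix ent ent' 1 c d W * y W) - (∑ W ∈ U.powerset, ν W * chainMix ent ent' 0 c d W * y W) * (∑ W ∈ U.powerset, ν W * chainMix ent ent' 1 c d W)) *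
          ((∑ W ∈ U.powerset, ν W * chainMix ent ent' 0 c d W) * (∑ W ∈ U.powerset, ν W * chainMix ent ent' 0 c d' W * x W) - (∑ W ∈ U.powerset, ν W * chainMix ent ent' 0 c d W * x W) * (∑ W ∈ U.powerset, ν W * chainMix ent ent' 0 c d' W))) ≤
        (∑ W ∈ U.powerset, ν W * chainMix ent ent' 0 c d W) * ((∑ W ∈ U.powerset, ν W * chainMix ent ent' 0 c d W) * (∑ W ∈ U.powerset, ν W * chainMix ent ent' 0 c d W) * (∑ W ∈ U.powerset, ν W * chainMix ent ent' 1 c d' W * (x W * y W))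
          - (∑ W ∈ U.powerset, ν W * chainMix ent ent' 0 c d W) * (∑ W ∈ U.powerset, ν W * chainMix ent ent' 0 c d W * y W) * (∑ W ∈ U.powerset, ν W * chainMix ent ent' 1 c d' W * x W)
          - (∑ W ∈ U.powerset, ν W * chainMix ent ent' 0 c d W) * (∑ W ∈ U.powerset, ν W * chainMix ent ent' 0 c d W * x W) * (∑ W ∈ U.powerset, ν W * chainMix ent ent' 1 c d' W * y W)
          + (∑ W ∈ U.powerset, ν W * chainMix ent ent' 0 c d W * x W) * (∑ W ∈ U.powerset, ν W * chainMix ent ent' 0 c d W * y W) * (∑ W ∈ U.powerset, ν W * chainMix ent ent' 1 c d' W))) :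
    0 ≤ (∑ W ∈ U.powerset, ν W * chainMix ent ent' ρ c d W) ^ 2 *
          (∑ W ∈ U.powerset, ν W * chainMix ent ent' ρ c d' W * (x W * y W))
        - (∑ W ∈ U.powerset, ν W * chainMix ent ent' ρ c d W) *
          (∑ W ∈ U.powerset, ν W * chainMix ent ent' ρ c d W * x W) *
          (∑ W ∈ U.powerset, ν W * chainMix ent ent' ρ c d' W * y W)
        - (∑ W ∈ U.powerset, ν W * chainMix ent ent' ρ c d W) *
          (∑ W ∈ U.powerset, ν W * chainMix ent ent' ρ c d W * y W) *
          (∑ W ∈ U.powerset, ν W * chainMix ent ent' ρ c d' W * x W)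
        + (∑ W ∈ U.powerset, ν W * chainMix ent ent' ρ c d W * x W) *
          (∑ W ∈ U.powerset, ν W * chainMix ent ent' ρ c d W * y W) *
          (∑ W ∈ U.powerset, ν W * chainMix ent ent' ρ c d' W) := by
  have hU000 := chain_world1_mixed_nonneg U ent ∅ ν c d d' 1 1 zero_le_one le_rfl zero_le_one
    le_rfl hν0 hν hc0 hd0 hd'0 hdc hd'c hcc hdd hd'd' hcd hcd' hdd' hratio hratio' x y hx0 hy0 hxm hym
  simp only [← chainMix_zero_as_one_empty ent ent'] at hU000
  refine chain_functional_nonneg_of_XA_Qprime U ent ent' ν c d d' ρ hρ0 hρ1 hν0 hν hc0 hd0 hd'0 hdc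
    hd'c hd'd hcc hdd hd'd' hcd hcd' hdd' hratio hratio' x y hx0 hy0 hxm hym hpos0 hpos1 ?_
    (chain_Qprime U ent ent' ν c d d' hν0 hν hc0 hd0 hd'0 hdc hd'c hd'd hcc hdd hd'd' hcd hcd' hdd'
      hratio hratio' x y hx0 hy0 hxm hym hpos0 hpos1 hmI)
  rw [chain_XA_identity]
  refine mul_nonneg hpos1.le ?_
  have h1 := mul_nonneg hpos1.le hU000
  linarith

end XACrossChain

end Summit.Ventures.PercRepro2.Coin
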